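import Summits.Ventures.PercRepro.RankLevelSetMultCubeCountIndep
import Summits.Ventures.PercRepro.S2IndepSixCount

/-!
# PercRepro — THE INDEPENDENT-6-SET CORRECTION INSIDE A LEVEL-6 CELL: THE TWO ARITHMETIC STEPS (p8 g8, S3)

`proofs/SUBCLAIM-S3-p8.md` §3v (i). (1) `indep_six_le_q`: p7's `S2.ncard_indep_six_add_le` in `ℚ` on a core of `n`
points — `#{independent 6-sets} ≤ C(n, 6) + C(s₃, 2)·(n − 5) − s₃·C(n − 3, 3)`. (2) `cell_indep_mono`: the corrected
cell bound is INCREASING in the true triangle count `s ≤ c`: with `A = C(n − 3, 3) ≤ W = C(n − 3, 4)`, a weight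
`σ ≥ 1` and `τ ≥ 0`, `[C₆ + C(s, 2)·n₅ − s·A] + (σ + τ)·(s·W + R) ≤ [C₆ + C(c, 2)·n₅ − c·A] + (σ + τ)·(c·W + R)`
(`(c − s)·A ≤ (c − s)·W ≤ (c − s)·(σ + τ)·W` and `C(s, 2) ≤ C(c, 2)`), so a cell may carry the correction at the cap `c₃`
while its pair count is charged at `c₃` as before. Also `one_le_cube_sum`: the cube weight sum starts with the term `1`.
Axioms: standard.
-/

open scoped Matroid

namespace PercRepro

namespace ThmN

open Set

variable {α : Type}

/-- p7's independent-6-set bound in `ℚ`, on `n = |E|` points. -/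
theorem indep_six_le_q (M : Matroid α) [M.Finite] (hC1 : ∀ L ⊆ M.E, M.eRk L = 2 → L.ncard ≤ 3) {n : ℕ}
    (hn : M.E.ncard = n) :
    ({B : Set α | B ⊆ M.E ∧ B.ncard = 6 ∧ M.eRk B = 6}.ncard : ℚ) ≤
      ((n.choose 6 : ℕ) : ℚ) +
        ((({C : Set α | M.IsCircuit C ∧ C.ncard = 3}.ncard).choose 2 : ℕ) : ℚ) * ((n - 5 : ℕ) : ℚ) -
        ({C : Set α | M.IsCircuit C ∧ C.ncard = 3}.ncard : ℚ) * (((n - 3).choose 3 : ℕ) : ℚ) := by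
  have h := S2.ncard_indep_six_add_le (M := M) hC1
  rw [hn] at h
  have h' : (({B : Set α | B ⊆ M.E ∧ B.ncard = 6 ∧ M.eRk B = 6}.ncard : ℕ) : ℚ) +
      ({C : Set α | M.IsCircuit C ∧ C.ncard = 3}.ncard : ℚ) * (((n - 3).choose 3 : ℕ) : ℚ) ≤
      ((n.choose 6 : ℕ) : ℚ) +
        ((({C : Set α | M.IsCircuit C ∧ C.ncard = 3}.ncard).choose 2 : ℕ) : ℚ) * ((n - 5 : ℕ) : ℚ) := by
    exact_mod_cast h
  linarith

/-- The cube-weight sum `Σ_{i < m} C(a, i)/cube(i + 1)` is at least its first term `1` when `m ≥ 1`. -/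
theorem one_le_cube_sum (a m : ℕ) (hm : 1 ≤ m) :
    (1 : ℚ) ≤ ∑ i ∈ Finset.range m, ((Nat.choose a i : ℕ) : ℚ) * (1 / ((((i + 1) * ((i + 1) ^ 2 + 1) / 2 : ℕ) : ℚ))) := by
  have h := Finset.single_le_sum (f := fun i => ((Nat.choose a i : ℕ) : ℚ) * (1 / ((((i + 1) * ((i + 1) ^ 2 + 1) / 2 : ℕ) : ℚ))))
    (fun i _ => by positivity) (Finset.mem_range.2 (by omega : 0 < m))
  simpa using h

/-- **The corrected cell bound is increasing in the true triangle count**: for `s ≤ c` (naturals), `C(s, 2) ≤ C(c, 2)`,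
`0 ≤ A ≤ W`, `1 ≤ σ`, `0 ≤ τ`, `0 ≤ n₅`:
`[C₆ + C(s,2)·n₅ − s·A] + σ·(s·W + R) + τ·(s·W + R) ≤ [C₆ + C(c,2)·n₅ − c·A] + σ·(c·W + R) + τ·(c·W + R)`. -/
theorem cell_indep_mono {s c : ℕ} (hsc : s ≤ c) {C₆ n₅ A W R σ τ : ℚ} (hA : 0 ≤ A) (hAW : A ≤ W) (hσ : 1 ≤ σ)
    (hτ : 0 ≤ τ) (hn₅ : 0 ≤ n₅) :
    (C₆ + ((s.choose 2 : ℕ) : ℚ) * n₅ - (s : ℚ) * A) + σ * ((s : ℚ) * W + R) + τ * ((s : ℚ) * W + R) ≤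
      (C₆ + ((c.choose 2 : ℕ) : ℚ) * n₅ - (c : ℚ) * A) + σ * ((c : ℚ) * W + R) + τ * ((c : ℚ) * W + R) := by
  have hch : ((s.choose 2 : ℕ) : ℚ) ≤ ((c.choose 2 : ℕ) : ℚ) := by exact_mod_cast Nat.choose_le_choose 2 hsc
  have hcs : (0 : ℚ) ≤ (c : ℚ) - (s : ℚ) := by
    have : (s : ℚ) ≤ (c : ℚ) := by exact_mod_cast hsc
    linarith
  have hW : (0 : ℚ) ≤ W := hA.trans hAW
  have h1 : ((c : ℚ) - (s : ℚ)) * A ≤ ((c : ℚ) - (s : ℚ)) * W := mul_le_mul_of_nonneg_left hAW hcs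
  have h2 : ((c : ℚ) - (s : ℚ)) * W ≤ ((c : ℚ) - (s : ℚ)) * W * (σ + τ) := by
    have hστ : (1 : ℚ) ≤ σ + τ := by linarith
    have h0 : (0 : ℚ) ≤ ((c : ℚ) - (s : ℚ)) * W := mul_nonneg hcs hW
    nlinarith
  have h3 : (((s.choose 2 : ℕ) : ℚ) - ((c.choose 2 : ℕ) : ℚ)) * n₅ ≤ 0 :=
    mul_nonpos_of_nonpos_of_nonneg (by linarith) hn₅
  nlinarith [h1, h2, h3]

end ThmN

end PercRepro
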